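import Literature.Analysis.FluidPDE.NSLocalLerayFarFieldRegularLeaves
import Literature.Analysis.FluidPDE.NSBoundedHigherRegularityQuantProofs
import HarnessLib

/-!
# Far-field / exterior regularity of local Leray solutions (Lemarié-Rieusset 2016, proof of Thm. 15.4, Step 2): three named facts, proved

Analysis/FluidPDE proof file (theorems only: no definition, no named fact, no `sorry`).  It composes
reductions that are already in the tree with `NSBoundedHigherRegularityBounds_holds`
(`NSBoundedHigherRegularityQuantProofs.lean`: the quantitative higher-regularity bounds for bounded
distributional Navier–Stokes solutions, Seregin–Šverák 2009, §2 p. 8 = Serrin's interior regularity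
with constants, proved by the Serrin bootstrap `NSBootstrap*.lean`), which was the last open
hypothesis of each reduction used below.  No statement is changed; each `X_holds : X` turns the
named fact `X` from literature debt into a theorem.
-/

namespace Literature.Analysis.FluidPDE

/-- **Serrin regularity in the exterior region for a bounded local Leray solution, proved**: `localLeray_exterior_vorticity_regular_of_bounded` holds — `…_of_printed_leaves` (NSLocalLerayFarFieldRegularLeaves.lean) fed with `NSBoundedHigherRegularityBounds_holds`.
[cite: LemarieRieusset2016, proof of Thm. 15.4, Step 2 (2nd sentence) and Step 3 ¶1 (PDF p. 569), with Thm. 13.1 (p. 436) and p. 438] -/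
theorem localLeray_exterior_vorticity_regular_of_bounded_holds : localLeray_exterior_vorticity_regular_of_bounded :=
  localLeray_exterior_vorticity_regular_of_bounded_of_printed_leaves NSBoundedHigherRegularityBounds_holds

/-- **Far-field regularity of local Leray solutions with `L³` data and the vorticity equation there, proved**: `localLeray_farField_vorticity_regular` holds — `…_of_printed_leaves` (NSLocalLerayFarFieldRegularLeaves.lean) fed with `NSBoundedHigherRegularityBounds_holds`.
[cite: LemarieRieusset2016, proof of Thm. 15.4, Step 2 and Step 3 ¶1 (PDF pp. 568–569), via Thm. 14.5 and Thm. 13.1] -/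
theorem localLeray_farField_vorticity_regular_holds : localLeray_farField_vorticity_regular :=
  localLeray_farField_vorticity_regular_of_printed_leaves NSBoundedHigherRegularityBounds_holds

/-- **The same on a slab, up to the final time, proved**: `localLeray_farField_vorticity_regular_slab` holds — `…_slab_of_printed_leaves` (NSLocalLerayFarFieldRegularLeaves.lean) fed with `NSBoundedHigherRegularityBounds_holds`.
[cite: LemarieRieusset2016, proof of Thm. 15.4, Step 2 and Step 3 ¶1 (PDF pp. 568–569), via Thm. 14.5 and Thm. 13.1] -/
theorem localLeray_farField_vorticity_regular_slab_holds : localLeray_farField_vorticity_regular_slab :=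
  localLeray_farField_vorticity_regular_slab_of_printed_leaves NSBoundedHigherRegularityBounds_holds

end Literature.Analysis.FluidPDE
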